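import Literature.RingTheory.Idempotents.CentralIdempotents
import Mathlib.RingTheory.Idempotents
import Mathlib.RingTheory.SimpleModule.Basic
import Mathlib.RingTheory.Artinian.Module
import Mathlib.LinearAlgebra.FiniteDimensional.Basic
import Mathlib.Algebra.Algebra.Hom.Rat
import Mathlib.Algebra.Module.LinearMap.Rat
import Mathlib.NumberTheory.NumberField.Basic
import HarnessLib

/-!
# The block `Z(H)·ε` of the centre of a SEMISIMPLE subalgebra is a number field (the Hecke block field without Rosati)

Topic `RingTheory/Idempotents`; namespace `Literature.RingTheory.Idempotents`.  THEOREMS ONLY (no definition, no named fact, no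
instance, no `sorry`); Mathlib + ★ `CentralIdempotents` (`IsCentrallyPrimitive`).  Sibling of ★ `PositiveInvolutionCentreBlockField`
(`exists_centreBlockField`: the same block field from a POSITIVE ANTI-INVOLUTION stabilising `H`); here the reducedness of the centre
comes from SEMISIMPLICITY of `H` instead, and the output carries no involution.

[Lam2001FirstCourse] §3 Thm. (3.5) (Wedderburn–Artin, pp. 33–35): a semisimple ring is `∏ M_{n_i}(D_i)`, so its centre `∏ Z(D_i)` is
a finite product of fields — in particular REDUCED, and each block `Z(H)·ε` at a centrally primitive idempotent `ε` (the `c_i` of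
§22 Prop. (22.1), p. 327) is ONE of these fields.  We prove this without choosing a Wedderburn–Artin decomposition:

* §1 `eq_zero_of_isNilpotent_of_central_of_isSemisimpleRing` — a semisimple ring has no non-zero CENTRAL nilpotent: the left
  ideal `S z` is generated by an idempotent `e = r z` (Mathlib `IsSemisimpleRing.ideal_eq_span_idempotent`), and `e = eⁿ = rⁿ zⁿ = 0`.
* §2 **`exists_centreBlockField_of_isSemisimpleRing`** — for a finite-dimensional `ℚ`-algebra `D`, a subalgebra `H ⊆ D` that is a
  SEMISIMPLE ring, and a centrally primitive idempotent `ε` of `H`: there are a number field `R₀` and an injective multiplicative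
  `ℚ`-linear `φ : R₀ → D` with `φ 1 = ε`, `φ(R₀) ⊆ H` central in `H`, `φ r · ε = φ r`, and `φ(R₀) = Z(H)·ε` (every central `z ∈ H`
  has `z ε ∈ φ(R₀)`) — the proof of ★ `exists_centreBlockField` with §1 in place of positivity (`Z(H)` reduced and Artinian ⇒
  semisimple commutative ⇒ every ideal of `Z(H)` is generated by an idempotent, which on the block is `0` or `ε`).

Cell `hodgecm-mathlib` (d6 S2′, A-p03 (g11) census `CENSUS-SocketRos-RoadB` road (i′)): `D = End⁰(A_K)`, `H = heckeImage K` —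
semisimple under the `G`-level semisimplicity of `ℚ̄_ℓ ⊗ H¹_ét(A_∞)` (★ `isSemisimpleRing_heckeImage_of_isSemisimpleRepresentation`) — and
`ε` the block of an irreducible constituent (★ `exists_blockProjector'`): the block field `R₀ = Z(heckeImage K)·ε` and its embedding
`φ` no longer need the Rosati involution; only «`R₀` is CM» does ([Liu2021] p. 140).  Count-neutral (HC_CM is proved only modulo
the 7 printed citations until rung 0 closes).

## References
* [Lam2001FirstCourse] T. Y. Lam, *A First Course in Noncommutative Rings*, 2nd ed., GTM 131 (2001): §3 Thm. (3.5) (pp. 33–35); §22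
  Prop. (22.1) (p. 327).
* [Liu2021] Y. Liu, *Fourier–Jacobi cycles and arithmetic relative trace formula*, Camb. J. Math. 9 (2021), App. D, proof of
  Thm. D.6 (1) (p. 140).
-/

noncomputable section

namespace Literature.RingTheory.Idempotents

open Module Function

universe u

/-! ## §1 A semisimple ring has no non-zero central nilpotent -/

/-- **No non-zero central nilpotents in a semisimple ring.**  If `z` is central and nilpotent in a semisimple ring `S`, then
`z = 0`: the left ideal `S z` is generated by an idempotent `e` (Mathlib `IsSemisimpleRing.ideal_eq_span_idempotent`), `e = r z`,
and since `z` is central `e = eⁿ = rⁿ zⁿ = 0` for `n` large, so `S z = 0`. [cite: Lam2001FirstCourse, §3 Thm. (3.5) (pp. 33–35)] -/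
theorem eq_zero_of_isNilpotent_of_central_of_isSemisimpleRing {S : Type*} [Ring S] [IsSemisimpleRing S] {z : S}
    (hzc : ∀ y : S, z * y = y * z) (hn : IsNilpotent z) : z = 0 := by
  obtain ⟨e, he, hspan⟩ := IsSemisimpleRing.ideal_eq_span_idempotent (Ideal.span {z})
  have hex : e ∈ Ideal.span {z} := by rw [hspan]; exact Ideal.mem_span_singleton_self e
  obtain ⟨r, hr⟩ := Ideal.mem_span_singleton'.1 hex
  obtain ⟨n, hzn⟩ := hn
  have he0 : e = 0 := by
    cases n with
    | zero =>
      rw [pow_zero] at hzn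
      haveI := subsingleton_of_zero_eq_one hzn.symm
      exact Subsingleton.elim _ _
    | succ k =>
      have hc : Commute r z := (hzc r).symm
      rw [← he.pow_succ_eq k, ← hr, hc.mul_pow, hzn, mul_zero]
  have hz : z ∈ Ideal.span {e} := by rw [← hspan]; exact Ideal.mem_span_singleton_self z
  rwa [he0, Ideal.span_singleton_eq_bot.2 rfl, Ideal.mem_bot] at hz

/-! ## §2 The block field `Z(H)·ε` of a semisimple subalgebra -/

variable {D : Type u} [Ring D] [Algebra ℚ D] [Module.Finite ℚ D]

/-- **THE BLOCK FIELD OF THE CENTRE OF A SEMISIMPLE SUBALGEBRA.**  For a finite-dimensional `ℚ`-algebra `D`, a subalgebra `H` that is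
a semisimple ring, and a block `ε` of `H` (centrally primitive idempotent), `Z(H)·ε` is a NUMBER FIELD: there are a number field `R₀`
and an injective multiplicative `ℚ`-linear `φ : R₀ → D` with `φ 1 = ε`, `φ(R₀) ⊆ H` central in `H`, `φ r · ε = φ r`, and
`φ(R₀) = {z ε ∣ z ∈ Z(H)}`.  (The centre `Z(H)` is reduced by §1, Artinian, hence semisimple commutative: every ideal is generated
by an idempotent, which on the block `ε` is `0` or `ε` because `ε` is centrally primitive — so the block is a field; characteristic
`0` and finite dimension make it a number field.) [cite: Lam2001FirstCourse, §3 Thm. (3.5) (pp. 33–35) and §22 Prop. (22.1) (p. 327)]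
[cite: Liu2021, App. D, proof of Thm. D.6 (1) (p. 140)] -/
theorem exists_centreBlockField_of_isSemisimpleRing (H : Subalgebra ℚ D) [IsSemisimpleRing H] {ε : D} (hεH : ε ∈ H)
    (hε : IsCentrallyPrimitive (⟨ε, hεH⟩ : H)) :
    ∃ (R₀ : Type u) (_ : Field R₀) (_ : NumberField R₀) (φ : R₀ →ₗ[ℚ] D),
      Function.Injective φ ∧ (∀ a b : R₀, φ (a * b) = φ a * φ b) ∧ φ 1 = ε ∧
      (∀ r : R₀, φ r ∈ H) ∧ (∀ r : R₀, ∀ y ∈ H, φ r * y = y * φ r) ∧ (∀ r : R₀, φ r * ε = φ r) ∧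
      ∀ z ∈ H, (∀ y ∈ H, z * y = y * z) → ∃ r : R₀, φ r = z * ε := by
  classical
  -- facts about `ε`
  have hεi : IsIdempotentElem ε := by
    have h := hε.idem.eq
    exact congrArg Subtype.val h
  have hεc : ∀ y ∈ H, ε * y = y * ε := fun y hy => congrArg Subtype.val (hε.comm ⟨y, hy⟩)
  have hε0 : ε ≠ 0 := fun h => hε.ne_zero (Subtype.ext h)
  have hprim : ∀ e : H, IsIdempotentElem e → (∀ a : H, e * a = a * e) → e * ⟨ε, hεH⟩ = e →
      e = 0 ∨ e = ⟨ε, hεH⟩ := (isCentrallyPrimitive_iff.1 hε).2.2.2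
  -- the centre `Z = Z(H)` and `ε ∈ Z`
  let Z : Subalgebra ℚ H := Subalgebra.center ℚ H
  let εZ : Z := ⟨⟨ε, hεH⟩, Subalgebra.mem_center_iff.2 fun b => (Subtype.ext (hεc b b.2)).symm⟩
  have hεZ : IsIdempotentElem εZ := Subtype.ext (Subtype.ext hεi.eq)
  -- the block `R₀ = Z·ε`, as the corner ring of `ε` in the commutative ring `Z`
  let R₀ : Type u := hεZ.Corner
  -- the embedding `f : R₀ → D`
  let f : R₀ → D := fun r => (((r.1 : Z) : H) : D)
  have hf_add : ∀ r s : R₀, f (r + s) = f r + f s := fun r s => rfl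
  have hf_mul : ∀ r s : R₀, f (r * s) = f r * f s := fun r s => rfl
  have hf_zero : f 0 = 0 := rfl
  have hf_one : f 1 = ε := rfl
  have hf_inj : Function.Injective f := fun r s h => Subtype.ext (Subtype.ext (Subtype.ext h))
  have hf_mem : ∀ r : R₀, f r ∈ H := fun r => ((r.1 : Z) : H).2
  have hf_central : ∀ r : R₀, ∀ y ∈ H, f r * y = y * f r := fun r y hy => by
    have h := Subalgebra.mem_center_iff.1 (r.1 : Z).2 ⟨y, hy⟩
    exact (congrArg Subtype.val h).symm
  have hf_eps : ∀ r : R₀, f r * ε = f r := fun r => by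
    have h := ((Subsemigroup.mem_corner_iff hεZ).1 r.2).2
    exact congrArg (fun t : Z => ((t : H) : D)) h
  have hf_surj : ∀ z ∈ H, (∀ y ∈ H, z * y = y * z) → ∃ r : R₀, f r = z * ε := by
    intro z hz hzc
    let zZ : Z := ⟨⟨z, hz⟩, Subalgebra.mem_center_iff.2 fun b => (Subtype.ext (hzc b b.2)).symm⟩
    refine ⟨⟨εZ * zZ * εZ, zZ, rfl⟩, ?_⟩
    change ε * z * ε = z * ε
    rw [hεc z hz, mul_assoc, hεi.eq]
  let fAdd : R₀ →+ D := { toFun := f, map_zero' := hf_zero, map_add' := hf_add }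
  -- `R₀` is a field: `Z` is reduced (§1: `H` is semisimple), Artinian, hence semisimple; an ideal of `Z` is generated by an
  -- idempotent, which is `0` or `ε` on the block
  have hF : IsField R₀ := by
    refine ⟨⟨0, 1, fun h => hε0 ?_⟩, mul_comm, fun {a} ha => ?_⟩
    · have h1 : f 0 = f 1 := congrArg f h
      rw [hf_zero, hf_one] at h1
      exact h1.symm
    · haveI : Module.Finite ℚ H := inferInstanceAs (Module.Finite ℚ H.toSubmodule)
      haveI : Module.Finite ℚ Z := inferInstanceAs (Module.Finite ℚ Z.toSubmodule)
      haveI : IsArtinianRing Z := IsArtinianRing.of_finite ℚ Z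
      haveI : IsReduced Z := ⟨fun z hz => by
        have hn : IsNilpotent (z : H) := hz.map Z.val
        have hzc : ∀ y : H, (z : H) * y = y * (z : H) := fun y => (Subalgebra.mem_center_iff.1 z.2 y).symm
        exact Subtype.ext (eq_zero_of_isNilpotent_of_central_of_isSemisimpleRing hzc hn)⟩
      haveI : IsSemisimpleRing Z := IsArtinianRing.isSemisimpleRing_of_isReduced Z
      obtain ⟨x, hx⟩ := a
      have hxε : x * εZ = x := ((Subsemigroup.mem_corner_iff hεZ).1 hx).2
      obtain ⟨e, he, hspan⟩ := IsSemisimpleRing.ideal_eq_span_idempotent (Ideal.span {x})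
      have hex : e ∈ Ideal.span {x} := by rw [hspan]; exact Ideal.mem_span_singleton_self e
      obtain ⟨b, hb⟩ := Ideal.mem_span_singleton'.1 hex
      have heε : e * εZ = e := by rw [← hb, mul_assoc, hxε]
      have hec : ∀ a : H, (e : H) * a = a * (e : H) := fun a =>
        (Subalgebra.mem_center_iff.1 e.2 a).symm
      rcases hprim (e : H) (congrArg Subtype.val he.eq) hec (congrArg Subtype.val heε) with h0 | h1
      · -- `e = 0`: then `x = 0`
        exfalso
        apply ha
        have he0 : e = 0 := Subtype.ext h0
        have hx0 : x ∈ Ideal.span {e} := by rw [← hspan]; exact Ideal.mem_span_singleton_self x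
        rw [he0, Ideal.span_singleton_eq_bot.2 rfl, Ideal.mem_bot] at hx0
        exact Subtype.ext hx0
      · -- `e = ε`: then `ε ∈ Z·x`, i.e. `x` is invertible in the block
        have he1 : e = εZ := Subtype.ext h1
        have hεx : εZ ∈ Ideal.span {x} := by rw [hspan, he1]; exact Ideal.mem_span_singleton_self _
        obtain ⟨c, hc⟩ := Ideal.mem_span_singleton'.1 hεx
        refine ⟨⟨εZ * c * εZ, c, rfl⟩, Subtype.ext ?_⟩
        change x * (εZ * c * εZ) = εZ
        rw [show x * (εZ * c * εZ) = c * x * (εZ * εZ) by ring, hc, hεZ.eq, hεZ.eq]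
  letI : Field R₀ := hF.toField
  -- characteristic zero: `f n = n • ε`
  haveI hchar : CharZero R₀ := by
    refine charZero_of_inj_zero fun n hn => ?_
    have h1 : f (n : R₀) = n • ε := by
      rw [show ((n : R₀)) = n • (1 : R₀) from (nsmul_one n).symm]
      exact (map_nsmul fAdd n (1 : R₀) : _)
    have h2 : (n : ℚ) • ε = 0 := by
      rw [Nat.cast_smul_eq_nsmul, ← h1, hn, hf_zero]
    rcases smul_eq_zero.1 h2 with h | h
    · exact_mod_cast h
    · exact absurd h hε0
  -- the `ℚ`-linear embedding and finiteness
  let φ : R₀ →ₗ[ℚ] D := fAdd.toRatLinearMap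
  have hφf : ∀ r, φ r = f r := fun r => rfl
  have hφ_inj : Function.Injective φ := fun a b h => hf_inj (by rwa [hφf, hφf] at h)
  have hφ_mul : ∀ a b : R₀, φ (a * b) = φ a * φ b := fun a b => by rw [hφf, hφf, hφf]; exact hf_mul a b
  haveI : FiniteDimensional ℚ R₀ := FiniteDimensional.of_injective φ hφ_inj
  haveI : NumberField R₀ := @NumberField.mk R₀ _ hchar inferInstance
  refine ⟨R₀, inferInstance, inferInstance, φ, hφ_inj, hφ_mul, hf_one, hf_mem, hf_central, hf_eps, ?_⟩
  intro z hz hzc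
  obtain ⟨r, hr⟩ := hf_surj z hz hzc
  exact ⟨r, hr⟩

end Literature.RingTheory.Idempotents

end
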